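import Literature.Computability.QuantumComplexity.BQPSubroutine
import Literature.Computability.QuantumComplexity.PolyMajority
import Literature.Computability.QuantumComplexity.CWrapUniform
import HarnessLib

/-!
# Deciders of every precision by padding the query, uniform in `⟨1^k, 1^r⟩` (BBBV 1997, Thm. 4.13 in two-parameter form)

Topic `Literature/Computability/QuantumComplexity`; sequel of `PolyMajority.lean` (every `A ∈ BQP` has
a uniform oracle-free family with error `≤ 1/(4(n+1)²)` on inputs of length `n`) toward the tidy
subroutines of `isQSolvable_of_mem_BQP_oracle` (Bennett–Bernstein–Brassard–Vazirani 1997, Thm. 4.14 /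
Cor. 4.15), which need, for every query length `k` AND every precision `r`, a decider of the queries
of length `k` with error `≤ 1/(r+1)²` (`DeciderFamily.Decides`, `BQPSubroutine.lean`), uniform in
`⟨1^k, 1^r⟩` (`DeciderFamily.IsUniform`). The error of a one-parameter family only shrinks with its
input length; so the query is **padded**: the decider for `(k, r)` writes `q 1 0 0^{2r}` (one `X` gate
on wire `k`; the zeros are free ancillas) and runs, on these `k + 2 + 2r` wires and its own ancillas,
the circuit of the low-error family for the *padded language* `padLang A = {s | unpad s ∈ A}`,
`unpad s = (sndF s⁻¹)⁻¹` (so that `unpad (q 1 0 0^{2j}) = q`: reversed, the padding is a `boolPair` of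
`0^j` and `q⁻¹`).

Part A — the law:
* `pad`, `unpad`, `unpad_pad`, `unpad_mem_FP`, `padLang`; **`padLang_mem_BQP`** — `BQP` is closed under
  this polynomial-time preprocessing: the classical wrap `CWrap.family` of `CWrapAssembly.lean` with
  pre-processor `unpad` and post-processor "the first output bit" (Bernstein–Vazirani 1997, §8);
* `PadDecider.family F₂` — the decider family built on a family `F₂` (meant for `padLang A`):
  `circ k r = xWord k ++ F₂.circ (k + 2 + 2r)` placed on the front wires; `family_isOracleFree`;
  **`acceptProb_circ`**: its acceptance probability on the query `q` is that of `F₂` on `pad q r`;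
  **`family_decides`**: if `F₂` decides `padLang A` with error `≤ 1/(4(n+1)²)` then the family decides
  `A` with error `≤ 1/(r+1)²` at precision `r`; `exists_deciderFamily_decides`.

Part B — uniformity in `⟨1^k, 1^r⟩` (`PadDecider.family_isUniform`): the description
`sigmaEncode ⟨k, dAnc k r, circ k r⟩` is assembled in the `FP` string algebra from the header `bin k`,
the ancilla count `1^{2 + 2r} 1^{F₂.ancillas (k+2+2r)}` (the middle field of `F₂`'s own description at
the unary input `1^{k + 2 + 2r}`, `QCircuitFamily.descFn ∈ FP`), the description bits of the `X` word
on wire `k` (the compiled `NOT k`, `RevDesc.opBits`, printed by the one-gate generator program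
`opsG [NOT uu]` at `uu = k`, `GStmt.render_out_mem_FP`), and the description of `F₂.circ (k + 2 + 2r)`
verbatim (`CWrap.gateEnc_mapWiresGate_castLEEmb`); transported to the two-parameter statement by
`PolyTimeComputable.of_encode`. Finally **`exists_uniform_deciderFamily`**: every `A ∈ BQP` has a
decider family, uniform in `⟨1^k, 1^r⟩` and oracle-free, with error `≤ 1/(r+1)²`.

## References

* C. H. Bennett, E. Bernstein, G. Brassard, U. Vazirani, *Strengths and weaknesses of quantum
  computing*, SIAM J. Comput. 26 (1997) 1510–1523, Thm. 4.13 ("for any `ε > 0` there is a QTM `M'`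
  which accepts `L` with probability `1 − ε`") [BennettBernsteinBrassardVazirani1997].
* E. Bernstein, U. Vazirani, *Quantum complexity theory*, SIAM J. Comput. 26 (1997), §8 (classical
  deterministic computation inside quantum machines) [BernsteinVazirani1997].
* S. Arora, B. Barak, *Computational Complexity: A Modern Approach*, CUP 2009, §6.2 Def. 6.12,
  Thm. 6.13 and Remark 6.7 [AroraBarak2009].
* M. A. Nielsen, I. L. Chuang, *Quantum Computation and Quantum Information*, CUP 2010, §4.2 Ex. 4.18
  (`X = HZH`), §4.3 [NielsenChuang2010].
-/

noncomputable section


namespace Literature.Computability.QuantumComplexity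

open _root_.Computability Complexity Complexity.Brick Cryptography Matrix Finset

/-! ### Padding and the padded language -/

namespace PadDecider

/-- **The padded query**: `q`, then `1 0`, then `2j` zeros. [folklore] -/
def pad (q : List Bool) (j : ℕ) : List Bool := q ++ [true, false] ++ List.replicate (2 * j) false

/-- **Unpadding**: reverse, drop the first component of the pair, reverse back. [folklore] -/
def unpad (s : List Bool) : List Bool := (sndF s.reverse).reverse

/-- The length of a padded query. [folklore] -/
@[simp] theorem length_pad (q : List Bool) (j : ℕ) : (pad q j).length = q.length + 2 + 2 * j := by
  simp [pad]; omega

/-- The reversed padding is a pair. [folklore] -/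
theorem reverse_pad (q : List Bool) (j : ℕ) : (pad q j).reverse = boolPair (List.replicate j false) q.reverse := by
  have hrep : (List.replicate j false).flatMap (fun b => [b, b]) = List.replicate (2 * j) false := by
    induction j with
    | zero => rfl
    | succ j ih => rw [List.replicate_succ, List.flatMap_cons, ih, show 2 * (j + 1) = 2 + 2 * j by ring, List.replicate_add]; rfl
  simp [pad, boolPair, hrep, List.reverse_replicate]

/-- **Unpadding a padded query gives the query.** [folklore] -/
@[simp] theorem unpad_pad (q : List Bool) (j : ℕ) : unpad (pad q j) = q := by
  rw [unpad, reverse_pad, sndF_boolPair, List.reverse_reverse]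

/-- `unpad ∈ FP`. [cite: AroraBarak2009, §1.3 (polynomial time is closed under composition)] -/
theorem unpad_mem_FP : unpad ∈ FP := comp_mem_FP reverse_mem_FP (comp_mem_FP sndF_mem_FP reverse_mem_FP)

/-- **The padded language**: the strings whose unpadding lies in `A`. [folklore] -/
def padLang (A : Language Bool) : Language Bool := {s | unpad s ∈ A}

/-- Membership of a padded query. [folklore] -/
theorem pad_mem_padLang_iff (A : Language Bool) (q : List Bool) (j : ℕ) : pad q j ∈ padLang A ↔ q ∈ A := by
  show unpad (pad q j) ∈ A ↔ q ∈ A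
  rw [unpad_pad]

/-! ### `padLang A ∈ BQP` -/

/-- The post-processor: the first bit of the measured string (`false` if it is empty). [folklore] -/
def firstBitF : List Bool → List Bool :=
  Plumb.takeFn ∘ fanoutFn (fun _ => [true]) ((fun y => y ++ [false]) ∘ sndF)

/-- `firstBitF ∈ FP`. [folklore] -/
theorem firstBitF_mem_FP : firstBitF ∈ FP :=
  comp_mem_FP Plumb.takeFn_mem_FP (fanoutFn_mem_FP (const_mem_FP _)
    (comp_mem_FP (append_mem_FP (PolyTimeComputable.id _) (const_mem_FP _)) sndF_mem_FP))

/-- Value of `firstBitF`. [folklore] -/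
theorem firstBitF_boolPair (x y : List Bool) : firstBitF (boolPair x y) = [y.headD false] := by
  simp only [firstBitF, Function.comp_apply, fanoutFn_apply, sndF_boolPair, Plumb.takeFn_boolPair, List.length_singleton]
  cases y <;> rfl

/-- Kernel probabilities of an event and of its complement add up to `1` (Clifford+T).
[cite: NielsenChuang2010, §2.2.5 (probabilities sum to one)] -/
theorem kernelProb_add_kernelProb_compl (F : QCircuitFamily cliffordT) (A : Language Bool) (x : List Bool) (E : Set (List Bool)) :
    F.kernelProb A x E + F.kernelProb A x Eᶜ = 1 := by
  classical
  unfold QCircuitFamily.kernelProb QCircuitFamily.kernel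
  rw [toReal_outputPMF_map_ofFn, toReal_outputPMF_map_ofFn, ← Finset.sum_add_distrib]
  have h1 := QCircuit.normSq_runOn_basisState cliffordT_isUnitary_holds A (F.circ x.length) x.get
  unfold normSq at h1
  rw [← h1]
  refine Finset.sum_congr rfl fun z _ => ?_
  by_cases hz : List.ofFn z ∈ E
  · rw [if_pos hz, if_neg (show ¬ (List.ofFn z ∈ Eᶜ) from fun h => h hz), add_zero]
  · rw [if_neg hz, if_pos (show List.ofFn z ∈ Eᶜ from hz), zero_add]

/-- **`BQP` is closed under the padding** (Karp reduction by `unpad`): classical pre-processing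
`unpad` and the read-out of the first output bit around a `BQP` family for `A`.
[cite: BernsteinVazirani1997, §8 (classical computation inside quantum machines)] -/
theorem padLang_mem_BQP {A : Language Bool} (hA : A ∈ BQP) : padLang A ∈ BQP := by
  classical
  obtain ⟨F, hFfree, hFU, hF⟩ := ClassBQP.mem_BQP_iff.1 hA
  obtain ⟨P, hPh, hPg, hPF⟩ := CWrap.exists_params unpad_mem_FP firstBitF_mem_FP hFU
  refine ClassBQP.mem_BQP_iff.2 ⟨CWrap.family P, CWrap.family_isOracleFree P (hPF ▸ hFfree), CWrap.family_isUniform P (hPF ▸ hFU),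
    fun x => ⟨fun hx => ?_, fun hx => ?_⟩⟩
  · -- yes-instances: the given family writes `true` first on `unpad x` with probability `≥ 2/3`
    have hker := CWrap.kernelProb_family_ge P x (fun _ => {y | [true] <+: y})
    rw [hPh, hPg, hPF] at hker
    have hsub : {z | ∃ y ∈ ({y | [true] <+: y} : Set (List Bool)), firstBitF (boolPair x y) <+: z} ⊆ {z | [true] <+: z} := by
      rintro z ⟨y, hy, hz⟩
      rw [Set.mem_setOf_eq, List.singleton_prefix_iff_head?_eq_some] at hy
      rw [firstBitF_boolPair] at hz
      cases y with
      | nil => simp at hy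
      | cons b y => simp only [List.head?_cons, Option.some.injEq] at hy; subst hy; exact hz
    rw [← kernelProb_prefix_true_eq_acceptProbOn]
    have h1 : 2 / 3 ≤ F.kernelProb 0 (unpad x) {y | [true] <+: y} := by
      rw [kernelProb_prefix_true_eq_acceptProbOn]; exact (hF (unpad x)).1 hx
    exact (h1.trans hker).trans ((CWrap.family P).kernelProb_mono 0 x hsub)
  · -- no-instances: the given family does NOT write `true` first with probability `≥ 2/3`
    have hker := CWrap.kernelProb_family_ge P x (fun _ => {y | [true] <+: y}ᶜ)
    rw [hPh, hPg, hPF] at hker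
    have hsub : {z | ∃ y ∈ ({y | [true] <+: y}ᶜ : Set (List Bool)), firstBitF (boolPair x y) <+: z} ⊆ {z | [false] <+: z} := by
      rintro z ⟨y, hy, hz⟩
      rw [Set.mem_compl_iff, Set.mem_setOf_eq, List.singleton_prefix_iff_head?_eq_some] at hy
      rw [firstBitF_boolPair] at hz
      cases y with
      | nil => exact hz
      | cons b y =>
        cases b with
        | false => exact hz
        | true => exact absurd rfl hy
    have hc := kernelProb_add_kernelProb_compl F 0 (unpad x) {y | [true] <+: y}
    rw [kernelProb_prefix_true_eq_acceptProbOn] at hc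
    have h1 : 2 / 3 ≤ F.kernelProb 0 (unpad x) {y | [true] <+: y}ᶜ := by
      have := (hF (unpad x)).2 hx; linarith
    have h2 := (h1.trans hker).trans ((CWrap.family P).kernelProb_mono 0 x hsub)
    have h3 := kernelProb_add_kernelProb_le_one (CWrap.family P) 0 x disjoint_prefix_true_false
    rw [kernelProb_prefix_true_eq_acceptProbOn] at h3
    linarith

/-! ### The padded decider -/

variable (F₂ : QCircuitFamily cliffordT)

/-- The padded input length `k + 2 + 2r`. [folklore] -/
def N (k r : ℕ) : ℕ := k + 2 + 2 * r

/-- The ancillas of the decider: the `2 + 2r` padding wires and the ancillas of `F₂`. [folklore] -/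
def dAnc (k r : ℕ) : ℕ := 2 + 2 * r + F₂.ancillas (N k r)

variable {F₂}

/-- The two widths agree. [folklore] -/
theorem width_eq (k r : ℕ) : N k r + F₂.ancillas (N k r) = k + dAnc F₂ k r := by unfold dAnc N; omega

/-- The width is positive (indeed `> k`). [folklore] -/
theorem lt_width (k r : ℕ) : k < k + dAnc F₂ k r := by unfold dAnc; omega

variable (F₂)

/-- The placement of `F₂`'s register: the front wires (all of them; an index cast). [folklore] -/
def castE (k r : ℕ) : Fin (N k r + F₂.ancillas (N k r)) ↪ Fin (k + dAnc F₂ k r) := Fin.castLEEmb (width_eq k r).le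

/-- The pad wire `k`. [folklore] -/
def padW (k r : ℕ) : Fin (k + dAnc F₂ k r) := ⟨k, lt_width k r⟩

/-- **The circuit of the padded decider**: `X` on wire `k`, then `F₂.circ (k + 2 + 2r)` on the front.
[cite: BennettBernsteinBrassardVazirani1997, Thm. 4.13] -/
def circ (k r : ℕ) : QCircuit cliffordT (k + dAnc F₂ k r) :=
  ⟨xWord (padW F₂ k r) ++ (mapWires (castE F₂ k r) (F₂.circ (N k r))).gates⟩

/-- **The padded decider family.** [cite: BennettBernsteinBrassardVazirani1997, Thm. 4.13] -/
def family : DeciderFamily cliffordT := ⟨dAnc F₂, circ F₂⟩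

variable {F₂}

/-- The family is oracle-free (if `F₂` is). [folklore] -/
theorem family_isOracleFree (h : F₂.IsOracleFree) : (family F₂).IsOracleFree := by
  intro k r g hg
  rcases List.mem_append.1 hg with hg | hg
  · exact xWord_isOracleFree _ g hg
  · exact isOracleFree_mapWires _ (h _) g hg

/-- The padded query as a register of `F₂`'s input length. [folklore] -/
def qpad {k : ℕ} (q : QReg k) (r : ℕ) : QReg (N k r) := fun i => (pad (List.ofFn q) r).getD i false

/-- The padded query, entrywise. [folklore] -/
theorem qpad_apply {k : ℕ} (q : QReg k) (r : ℕ) (i : Fin (N k r)) :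
    qpad q r i = if h : (i : ℕ) < k then q ⟨i, h⟩ else decide ((i : ℕ) = k) := by
  unfold qpad pad
  rw [List.getD_eq_getElem?_getD, List.append_assoc]
  by_cases h : (i : ℕ) < k
  · rw [dif_pos h, List.getElem?_append_left (by simpa using h), List.getElem?_ofFn, dif_pos h]
    rfl
  · rw [dif_neg h, List.getElem?_append_right (by simpa using Nat.not_lt.1 h), List.length_ofFn]
    rcases Nat.lt_or_ge ((i : ℕ) - k) 2 with h2 | h2
    · have : (i : ℕ) - k = 0 ∨ (i : ℕ) - k = 1 := by omega
      rcases this with e | e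
      · rw [e]; simp; omega
      · rw [e]; simp; omega
    · rw [List.getElem?_append_right (by simpa using h2)]
      simp only [List.length_cons, List.length_nil]
      rw [List.getElem?_replicate]
      have hne : ¬ (i : ℕ) = k := by omega
      simp [hne]
      split_ifs <;> rfl

/-- **After the `X` gate the register holds `F₂`'s padded input `|pad q r, 0…0⟩`.** [folklore] -/
theorem update_padInput_eq {k : ℕ} (q : QReg k) (r : ℕ) :
    Function.update (padInput q (dAnc F₂ k r)) (padW F₂ k r) true ∘ Fin.castLE (width_eq k r).le =
      padInput (qpad q r) (F₂.ancillas (N k r)) := by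
  funext i
  simp only [Function.comp_apply]
  by_cases hik : ((Fin.castLE (width_eq (F₂ := F₂) k r).le i : Fin (k + dAnc F₂ k r)) = padW F₂ k r)
  · rw [hik, Function.update_self]
    have hi : (i : ℕ) = k := by simpa [padW] using congrArg Fin.val hik
    have hiN : (i : ℕ) < N k r := by unfold N; omega
    rw [show i = Fin.castAdd _ ⟨i, hiN⟩ from Fin.ext rfl, padInput, Fin.append_left, qpad_apply]
    simp [hi]
  · rw [Function.update_of_ne hik]
    have hi : (i : ℕ) ≠ k := fun h => hik (Fin.ext h)
    -- the right-hand side on the first `N` wires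
    have er : ∀ hiN : (i : ℕ) < N k r, padInput (qpad q r) (F₂.ancillas (N k r)) i = qpad q r ⟨i, hiN⟩ := fun hiN => by
      have h := Fin.append_left (qpad q r) (fun _ : Fin (F₂.ancillas (N k r)) => false) ⟨i, hiN⟩
      rwa [show Fin.castAdd (F₂.ancillas (N k r)) ⟨(i : ℕ), hiN⟩ = i from Fin.ext rfl] at h
    by_cases hlt : (i : ℕ) < k
    · rw [show (Fin.castLE (width_eq (F₂ := F₂) k r).le i : Fin (k + dAnc F₂ k r)) = Fin.castAdd _ ⟨i, hlt⟩ from Fin.ext rfl,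
        padInput, Fin.append_left]
      have hiN : (i : ℕ) < N k r := by unfold N; omega
      rw [er hiN, qpad_apply, dif_pos hlt]
    · rw [show (Fin.castLE (width_eq (F₂ := F₂) k r).le i : Fin (k + dAnc F₂ k r)) =
          Fin.natAdd k ⟨i - k, by have := i.isLt; have := width_eq (F₂ := F₂) k r; omega⟩ from Fin.ext (by simp; omega),
        padInput, Fin.append_right]
      by_cases hiN : (i : ℕ) < N k r
      · rw [er hiN, qpad_apply, dif_neg hlt]
        simp [hi]
      · have h := Fin.append_right (qpad q r) (fun _ : Fin (F₂.ancillas (N k r)) => false) ⟨i - N k r, by have := i.isLt; omega⟩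
        rw [show Fin.natAdd (N k r) ⟨(i : ℕ) - N k r, _⟩ = i from Fin.ext (by simp; omega)] at h
        rw [padInput, h]

/-- Acceptance probability along a length identity. [folklore] -/
theorem acceptProbOn_eq_of_length (F : QCircuitFamily cliffordT) (A : Language Bool) {x : List Bool} {n : ℕ} (h : x.length = n) :
    F.acceptProbOn A x = (F.circ n).acceptProb A (fun i => x.get (i.cast h.symm)) := by
  subst h; rfl

/-- **The padded decider accepts the query `q` exactly as often as `F₂` accepts `pad q r`.**
[cite: NielsenChuang2010, §4.3 (a gate on a subset of the wires is U ⊗ 1)] -/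
theorem acceptProb_circ {k : ℕ} (r : ℕ) (q : QReg k) :
    (circ F₂ k r).acceptProb 0 q = F₂.acceptProbOn 0 (pad (List.ofFn q) r) := by
  classical
  have hlen : (pad (List.ofFn q) r).length = N k r := by rw [length_pad, List.length_ofFn]; rfl
  rw [acceptProbOn_eq_of_length F₂ 0 hlen]
  have hget : (fun i : Fin (N k r) => (pad (List.ofFn q) r).get (i.cast hlen.symm)) = qpad q r := by
    funext i
    rw [qpad, List.getD_eq_getElem?_getD, List.get_eq_getElem, List.getElem?_eq_getElem]
    rfl
  rw [hget]
  -- the run: `X`, then the placed copy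
  have hrun : (circ F₂ k r).runOn 0 (basisState (padInput q (dAnc F₂ k r))) =
      placeGate (castE F₂ k r) ((F₂.circ (N k r)).toMatrix 0) *ᵥ
        basisState (Function.update (padInput q (dAnc F₂ k r)) (padW F₂ k r) true) := by
    rw [QCircuit.runOn, circ, show (⟨xWord (padW F₂ k r) ++ (mapWires (castE F₂ k r) (F₂.circ (N k r))).gates⟩ :
        QCircuit cliffordT (k + dAnc F₂ k r)) = (⟨xWord (padW F₂ k r)⟩ : QCircuit cliffordT _).append (mapWires (castE F₂ k r) (F₂.circ (N k r)))
        from rfl, QCircuit.toMatrix_append, ← Matrix.mulVec_mulVec, xWord_mulVec_basisState, toMatrix_mapWires]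
    congr 2
    have : padInput q (dAnc F₂ k r) (padW F₂ k r) = false := by
      rw [padW, show (⟨k, lt_width k r⟩ : Fin (k + dAnc F₂ k r)) = Fin.natAdd k ⟨0, by unfold dAnc; omega⟩ from Fin.ext (by simp),
        padInput, Fin.append_right]
    rw [this]; rfl
  have hpos : 0 < k + dAnc F₂ k r := lt_of_le_of_lt (Nat.zero_le k) (lt_width k r)
  have hposN : 0 < N k r + F₂.ancillas (N k r) := by unfold N; omega
  unfold QCircuit.acceptProb
  simp only [hpos, hposN, dif_pos]
  rw [hrun, castE]
  have hw : ∀ i : Fin (k + dAnc F₂ k r), N k r + F₂.ancillas (N k r) ≤ (i : ℕ) →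
      Function.update (padInput q (dAnc F₂ k r)) (padW F₂ k r) true i = false := fun i hi => by
    have := i.isLt; have := width_eq (F₂ := F₂) k r; omega
  have key := sum_normSq_placeGate_castLE (width_eq (F₂ := F₂) k r).le ((F₂.circ (N k r)).toMatrix 0)
    (Function.update (padInput q (dAnc F₂ k r)) (padW F₂ k r) true)
    (fun u : QReg (N k r + F₂.ancillas (N k r)) => u ⟨0, hposN⟩ = true)
  have e1 : ∀ y : QReg (k + dAnc F₂ k r), (y ⟨0, hpos⟩ = true) ↔ ((y ∘ Fin.castLEEmb (width_eq (F₂ := F₂) k r).le) ⟨0, hposN⟩ = true) :=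
    fun y => Iff.rfl
  rw [show (∑ y : QReg (k + dAnc F₂ k r), if y ⟨0, hpos⟩ = true then
      ‖(placeGate (Fin.castLEEmb (width_eq (F₂ := F₂) k r).le) ((F₂.circ (N k r)).toMatrix 0) *ᵥ
        basisState (Function.update (padInput q (dAnc F₂ k r)) (padW F₂ k r) true)) y‖ ^ 2 else 0) =
      ∑ y : QReg (k + dAnc F₂ k r), if ((y ∘ Fin.castLEEmb (width_eq (F₂ := F₂) k r).le) ⟨0, hposN⟩ = true) then
        ‖(placeGate (Fin.castLEEmb (width_eq (F₂ := F₂) k r).le) ((F₂.circ (N k r)).toMatrix 0) *ᵥ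
          basisState (Function.update (padInput q (dAnc F₂ k r)) (padW F₂ k r) true)) y‖ ^ 2 else 0
    from Finset.sum_congr rfl fun y _ => by simp only [e1], key]
  refine Finset.sum_congr rfl fun u _ => ?_
  rw [show (Function.update (padInput q (dAnc F₂ k r)) (padW F₂ k r) true ∘ Fin.castLEEmb (width_eq (F₂ := F₂) k r).le) =
      padInput (qpad q r) (F₂.ancillas (N k r)) from update_padInput_eq q r, QCircuit.runOn, mulVec_basisState]

/-- **The padded decider decides `A` with error `≤ 1/(r+1)²`** if `F₂` decides the padded language
with error `≤ 1/(4(n+1)²)` on inputs of length `n`. [cite: BennettBernsteinBrassardVazirani1997, Thm. 4.13] -/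
theorem family_decides {A : Language Bool}
    (hF₂ : ∀ s : List Bool, (s ∈ padLang A → 1 - 1 / (4 * ((s.length : ℝ) + 1) ^ 2) ≤ F₂.acceptProbOn 0 s) ∧
      (s ∉ padLang A → F₂.acceptProbOn 0 s ≤ 1 / (4 * ((s.length : ℝ) + 1) ^ 2))) :
    (family F₂).Decides A fun r => 1 / ((r : ℝ) + 1) ^ 2 := by
  intro k r q
  have hacc : ((family F₂).circ k r).acceptProb 0 q = F₂.acceptProbOn 0 (pad (List.ofFn q) r) := acceptProb_circ r q
  have hlen : ((pad (List.ofFn q) r).length : ℝ) = k + 2 + 2 * r := by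
    rw [length_pad, List.length_ofFn]; push_cast; ring
  have hbound : 1 / (4 * (((pad (List.ofFn q) r).length : ℝ) + 1) ^ 2) ≤ 1 / ((r : ℝ) + 1) ^ 2 := by
    rw [hlen]
    refine one_div_le_one_div_of_le (by positivity) ?_
    nlinarith [sq_nonneg ((r : ℝ) + 1), sq_nonneg ((k : ℝ) + r + 2), Nat.cast_nonneg (α := ℝ) k, Nat.cast_nonneg (α := ℝ) r]
  rw [hacc]
  constructor
  · intro hq
    have h := (hF₂ _).1 ((pad_mem_padLang_iff A _ r).2 hq)
    linarith
  · intro hq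
    have h := (hF₂ _).2 (fun h => hq ((pad_mem_padLang_iff A _ r).1 h))
    linarith

end PadDecider

/-- **Deciders of every inverse-polynomial precision** (Bennett–Bernstein–Brassard–Vazirani 1997,
Thm. 4.13, two-parameter form in the tree's model): for every `A ∈ BQP` there is a polynomial-time
uniform oracle-free family `F₂` deciding the padded language with error `≤ 1/(4(n+1)²)`
(`exists_uniform_family_inv_poly_error`, `PadDecider.padLang_mem_BQP`), and the padded decider family
built on it is oracle-free and decides `A` with error `≤ 1/(r+1)²` at every precision `r` on every
classical query. [cite: BennettBernsteinBrassardVazirani1997, Thm. 4.13] -/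
theorem exists_deciderFamily_decides {A : Language Bool} (hA : A ∈ BQP) :
    ∃ F₂ : QCircuitFamily cliffordT, F₂.IsOracleFree ∧ F₂.IsUniform ∧
      (PadDecider.family F₂).IsOracleFree ∧ (PadDecider.family F₂).Decides A fun r => 1 / ((r : ℝ) + 1) ^ 2 := by
  obtain ⟨F₂, hfree, hU, hF₂⟩ := exists_uniform_family_inv_poly_error (PadDecider.padLang_mem_BQP hA)
  exact ⟨F₂, hfree, hU, PadDecider.family_isOracleFree hfree, PadDecider.family_decides hF₂⟩

end Literature.Computability.QuantumComplexity

/-! ## Part B — uniformity in `⟨1^k, 1^r⟩` -/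


namespace Literature.Computability.QuantumComplexity

namespace PadDecider

open _root_.Computability Polynomial Complexity Complexity.Brick Plumb RevDesc RevSim RevClean Cryptography

variable (F₂ : QCircuitFamily cliffordT)

/-! ### The pieces of the description as string functions of `z` (canonically `⟨1^k, 1^r⟩`) -/

/-- The padded input length in unary: `1^k 1 1 1^r 1^r`. [folklore] -/
def NUF : List Bool → List Bool := fun z => fstF z ++ ([true, true] ++ (sndF z ++ sndF z))

/-- `F₂`'s own description at the padded length. [folklore] -/
def ddF : List Bool → List Bool := F₂.descFn ∘ NUF

/-- The ancilla count of the decider in unary: `1 1 1^r 1^r` then `F₂`'s ancilla count. [folklore] -/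
def ancUF : List Bool → List Bool := fun z => ([true, true] ++ (sndF z ++ sndF z)) ++ fstF (sndF (ddF F₂ z))

/-- The one-gate generator printing the `X` word on wire `uu`. [cite: AroraBarak2009, §6.2 (descriptions printed with counters)] -/
def genX : GS := opsG [ClOp.not (.var .uu)]

/-- The description bits of the `X` word on wire `|u|`, as a function of `u`. [folklore] -/
def xBitsF : List Bool → List Bool := fun u => Tok.render 0 ((genX).out (GenProg.initEnv GV.uu u.length))

/-- **The description of the padded decider** as a string function. [cite: AroraBarak2009, §6.2 Def. 6.12 and Remark 6.7] -/
def descF : List Bool → List Bool :=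
  fanoutFn (lenBinF ∘ fstF) (fanoutFn (ancUF F₂) (fun z => xBitsF (fstF z) ++ sndF (sndF (ddF F₂ z))))

variable {F₂}

/-- `NUF ∈ FP`. [folklore] -/
theorem NUF_mem_FP : NUF ∈ FP :=
  append_mem_FP fstF_mem_FP (append_mem_FP (const_mem_FP _) (append_mem_FP sndF_mem_FP sndF_mem_FP))

/-- `ddF ∈ FP` for a uniform `F₂`. [folklore] -/
theorem ddF_mem_FP (hU : F₂.IsUniform) : ddF F₂ ∈ FP := comp_mem_FP (QCircuitFamily.descFn_mem_FP_of_isUniform hU) NUF_mem_FP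

/-- `ancUF ∈ FP` for a uniform `F₂`. [folklore] -/
theorem ancUF_mem_FP (hU : F₂.IsUniform) : ancUF F₂ ∈ FP :=
  append_mem_FP (append_mem_FP (const_mem_FP _) (append_mem_FP sndF_mem_FP sndF_mem_FP))
    (comp_mem_FP fstF_mem_FP (comp_mem_FP sndF_mem_FP (ddF_mem_FP hU)))

/-- `xBitsF ∈ FP` (a generator program). [cite: AroraBarak2009, §6.2 Def. 6.12 and Remark 6.7] -/
theorem xBitsF_mem_FP : xBitsF ∈ FP := by
  have hx : GV.uu ∉ (genX).loopVars := fun h => absurd (loopVars_opsG_sub _ _ h) (by decide)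
  exact GStmt.render_out_mem_FP genX GV.uu hx (noReuse_opsG _)

/-- **`descF ∈ FP`** for a uniform `F₂`. [cite: AroraBarak2009, §6.2 Def. 6.12 and Remark 6.7] -/
theorem descF_mem_FP (hU : F₂.IsUniform) : descF F₂ ∈ FP := by
  have h1 : (xBitsF ∘ fstF) ∈ FP := comp_mem_FP xBitsF_mem_FP fstF_mem_FP
  have h2 : (sndF ∘ sndF ∘ ddF F₂) ∈ FP := comp_mem_FP sndF_mem_FP (comp_mem_FP sndF_mem_FP (ddF_mem_FP hU))
  have h3 : (fun z => (xBitsF ∘ fstF) z ++ (sndF ∘ sndF ∘ ddF F₂) z) ∈ FP := append_mem_FP h1 h2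
  exact fanoutFn_mem_FP (comp_mem_FP lenBinF_mem_FP fstF_mem_FP) (fanoutFn_mem_FP (ancUF_mem_FP hU) h3)

/-! ### Values on the canonical input `⟨1^k, 1^r⟩` -/

/-- The unary numeral is a run of `true`. [folklore] -/
theorem unaryEncodeNat_eq (n : ℕ) : unaryEncodeNat n = List.replicate n true := RevDesc.unaryEncodeNat_eq_replicate n

/-- `NUF` on the canonical input has the padded length. [folklore] -/
theorem length_NUF (k r : ℕ) : (NUF (unaryPairEncode (k, r))).length = N k r := by
  simp [NUF, unaryPairEncode, unaryEncodeNat_eq, N]; omega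

/-- `ddF` on the canonical input is `F₂`'s description at the padded length. [folklore] -/
theorem ddF_apply (k r : ℕ) : ddF F₂ (unaryPairEncode (k, r)) =
    boolPair (encodeNat (N k r)) (boolPair (unaryEncodeNat (F₂.ancillas (N k r))) (F₂.circ (N k r)).encode) := by
  rw [ddF, Function.comp_apply, QCircuitFamily.descFn_eq]
  have key : ∀ m, m = N k r → boolPair (encodeNat m) (boolPair (unaryEncodeNat (F₂.ancillas m)) (F₂.circ m).encode) =
      boolPair (encodeNat (N k r)) (boolPair (unaryEncodeNat (F₂.ancillas (N k r))) (F₂.circ (N k r)).encode) := by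
    rintro m rfl; rfl
  exact key _ (length_NUF k r)

/-- `ancUF` on the canonical input is the ancilla count in unary. [folklore] -/
theorem ancUF_apply (k r : ℕ) : ancUF F₂ (unaryPairEncode (k, r)) = unaryEncodeNat (dAnc F₂ k r) := by
  rw [ancUF, ddF_apply, sndF_boolPair, fstF_boolPair]
  simp only [unaryPairEncode, sndF_boolPair, unaryEncodeNat_eq, dAnc]
  rw [show 2 + 2 * r + F₂.ancillas (N k r) = 2 + (r + (r + F₂.ancillas (N k r))) by ring, List.replicate_add, List.replicate_add,
    List.replicate_add]
  simp only [List.append_assoc]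
  rfl

/-- **The `X` word describes as the compiled `NOT`.** [cite: AroraBarak2009, §6.1 (descriptions of circuits)] -/
theorem flatMap_gateEnc_xWord (k r : ℕ) : (xWord (padW F₂ k r)).flatMap gateEnc = opBits (ClOp.not k) := by
  have hW : 0 < k + dAnc F₂ k r := lt_of_le_of_lt (Nat.zero_le k) (lt_width k r)
  have hlt : ∀ i ∈ wiresOf (ClOp.not k), i < k + dAnc F₂ k r := fun i hi => by
    simp only [mem_wiresOf, ClOp.target, ClOp.controls, List.not_mem_nil, or_false] at hi
    rw [hi]; exact lt_width k r
  have hwf : ((ClOp.not k).map (finOf (k + dAnc F₂ k r) hW)).WF := trivial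
  have h := flatMap_gateEnc_compile_toRev hW (ClOp.not k) hlt hwf
  have e : ((ClOp.not k).map (finOf (k + dAnc F₂ k r) hW)).toRev hwf = RevOp.not (padW F₂ k r) := by
    simp only [ClOp.map, ClOp.toRev]
    congr 1
    exact Fin.ext (val_finOf_of_lt hW (lt_width k r))
  rw [e] at h
  exact h

/-- `xBitsF` on a string of length `k` gives the description bits of the `X` word. [folklore] -/
theorem xBitsF_apply (u : List Bool) (r : ℕ) : xBitsF u = (xWord (padW F₂ u.length r)).flatMap gateEnc := by
  rw [flatMap_gateEnc_xWord, xBitsF, genX, out_opsG, List.map_cons, List.map_nil]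
  simp only [ClOp.map, GExpr.eval, GenProg.initEnv_self]
  rw [render_flatMap_opToks_nil, List.flatMap_cons, List.flatMap_nil, List.append_nil]

/-- **The description of the decider circuit**: the `X` bits, then `F₂`'s description verbatim.
[cite: AroraBarak2009, §6.2 (a circuit for each input length, hard-wired)] -/
theorem encode_circ (k r : ℕ) : (circ F₂ k r).encode = (xWord (padW F₂ k r)).flatMap gateEnc ++ (F₂.circ (N k r)).encode := by
  rw [circ, show QCircuit.encode (⟨xWord (padW F₂ k r) ++ (mapWires (castE F₂ k r) (F₂.circ (N k r))).gates⟩ : QCircuit cliffordT _) =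
      (xWord (padW F₂ k r) ++ (mapWires (castE F₂ k r) (F₂.circ (N k r))).gates).flatMap gateEnc from encode_eq_flatMap _,
    List.flatMap_append]
  congr 1
  rw [show (F₂.circ (N k r)).encode = QCircuit.encode (⟨(F₂.circ (N k r)).gates⟩ : QCircuit cliffordT _) from rfl, encode_eq_flatMap]
  simp only [mapWires, castE, List.flatMap_map, CWrap.gateEnc_mapWiresGate_castLEEmb]

/-- **`descF` on the canonical input is the description of the padded decider.** [folklore] -/
theorem descF_apply (k r : ℕ) :
    descF F₂ (unaryPairEncode (k, r)) = QCircuit.sigmaEncode (G := cliffordT) ⟨k, dAnc F₂ k r, circ F₂ k r⟩ := by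
  rw [QCircuit.sigmaEncode_eq, descF, fanoutFn_apply, fanoutFn_apply, Function.comp_apply, ancUF_apply, encode_circ, ddF_apply,
    sndF_boolPair, sndF_boolPair]
  have hk : fstF (unaryPairEncode (k, r)) = unaryEncodeNat k := by simp [unaryPairEncode]
  rw [hk, lenBinF_apply, xBitsF_apply (F₂ := F₂) _ r]
  have hl : (unaryEncodeNat k).length = k := Computability.unary_decode_encode_nat k
  rw [hl]

/-- **The padded decider family is uniform in `⟨1^k, 1^r⟩`** (if `F₂` is uniform).
[cite: AroraBarak2009, §6.2 Def. 6.12 and Remark 6.7 (descriptions printed in polynomial time)] -/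
theorem family_isUniform (hU : F₂.IsUniform) : (family F₂).IsUniform :=
  PolyTimeComputable.of_encode (descF_mem_FP hU) unaryPairEncode (fun _ => rfl) fun p => by
    obtain ⟨k, r⟩ := p
    exact descF_apply k r

end PadDecider

/-- **Uniform deciders of every inverse-polynomial precision** (Bennett–Bernstein–Brassard–Vazirani
1997, Thm. 4.13, two-parameter form): for every `A ∈ BQP` there is a decider family, uniform in
`⟨1^k, 1^r⟩` and oracle-free, deciding `A` with error `≤ 1/(r+1)²` at every precision `r` on every
classical query. [cite: BennettBernsteinBrassardVazirani1997, Thm. 4.13] -/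
theorem exists_uniform_deciderFamily {A : Language Bool} (hA : A ∈ Cryptography.BQP) :
    ∃ D : DeciderFamily Cryptography.cliffordT, D.IsUniform ∧ D.IsOracleFree ∧ D.Decides A fun r => 1 / ((r : ℝ) + 1) ^ 2 := by
  obtain ⟨F₂, _, hU, hfree, hdec⟩ := exists_deciderFamily_decides hA
  exact ⟨PadDecider.family F₂, PadDecider.family_isUniform hU, hfree, hdec⟩

end Literature.Computability.QuantumComplexity

end
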